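import Summits.Ventures.PercRepro.MSTwinProj
import Summits.Ventures.PercRepro.MSTwinLemmaA
import Summits.Ventures.PercRepro.MSTwinLemmaB
import Summits.Ventures.PercRepro.MS3RegimeTL

/-!
# Theorem S: the equality cases of the Marica–Schönheim inequality, and `TLGeneral`

**Theorem S** (proofs/MINE1-theoremS.md): a family `F` of finite sets is tight
(`|F \\ F| = |F|`) iff, after removing the core and contracting twin classes, it is a product of a
down-set and an up-set on complementary supports. This file proves the hard direction in the
class-level form `dichotomy_of_tight`: **every twin class of a tight family is addable or
removable** (`Dichotomy F`), by strong induction on the support `u`: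

* an element in no member / in every member is trivially removable / addable;
* an element `a` with a twin `b ≠ a`: project along `b` (`proj b F` is tight, on `u.erase b`) and
  lift the dichotomy at `a` back (`MSTwinProj.lean`);
* a twin-free `a` lying in some member and missing another: the projection and the partner family
  are tight on `u.erase a`, so both satisfy the dichotomy; Lemma A (`MSTwinLemmaA.lean`) makes
  the partner family nonempty, Lemma B (`MSTwinLemmaB.lean`) gives the dichotomy at `a`.

With the dichotomy, `MSTwinProduct.lean` yields the product structure
(`diffs_eq_flip_of_tight`: `F \\ F = flip (Rstar F) F`, `flip_eq_sups_within_of_tight`, the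
product form `tight_eq_sups_of_tight` and the characterisation
`tight_iff_dichotomy_and_flip_eq_sups`), the difference-closure of `F \\ F`
(`diffs_diffs_eq_of_tight`), the twin classes as the atoms of `F \\ F`
(`cls_mem_diffs_of_tight`, `exists_cls_subset_of_mem_diffs`), the convexity of tight families on
twin-closed sets, and the **general mixed-cell lemma**
`mem_or_compl_mem_of_tight`. The latter is exactly the candidate proposition `TLGeneral S` of
`MS3RegimeTL.lean`, so it holds for every finite type (`tlGeneral`), and the coloured
Marica–Schönheim statement `MSr 3` holds unconditionally whenever some type has at most one pair
(`msr3_card_le_of_small_type'`).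
-/

namespace PercRepro.MSTight

open Finset
open scoped FinsetFamily symmDiff

variable {α : Type*} [DecidableEq α] [Fintype α]

/-- The class of an element lying in no member is removable. -/
theorem closedRem_cls_of_forall_notMem {F : Finset (Finset α)} {a : α} (h : ∀ t ∈ F, a ∉ t) :
    ClosedRem F (cls F a) := by
  intro t ht
  rw [sdiff_eq_self_of_disjoint (disjoint_cls_of_notMem ht (h t ht)).symm]
  exact ht

/-- The class of an element lying in every member is addable. -/
theorem closedAdd_cls_of_forall_mem {F : Finset (Finset α)} {a : α} (h : ∀ t ∈ F, a ∈ t) :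
    ClosedAdd F (cls F a) := by
  intro t ht
  rw [union_eq_left.2 (cls_subset_of_mem ht (h t ht))]
  exact ht

/-- **Theorem S, the class dichotomy**, by strong induction on the support. -/
theorem dichotomy_of_tight_aux (u : Finset α) :
    ∀ F : Finset (Finset α), (∀ A ∈ F, A ⊆ u) → Tight F → Dichotomy F := by
  induction u using Finset.strongInduction with
  | H u ih =>
    intro F hFu hF a
    by_cases h0 : ∀ t ∈ F, a ∉ t
    · exact Or.inr (closedRem_cls_of_forall_notMem h0)
    by_cases h1 : ∀ t ∈ F, a ∈ t
    · exact Or.inl (closedAdd_cls_of_forall_mem h1)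
    push Not at h0 h1
    obtain ⟨t₁, ht₁, hat₁⟩ := h0
    obtain ⟨t₀, ht₀, hat₀⟩ := h1
    have hau : a ∈ u := hFu t₁ ht₁ hat₁
    by_cases htf : ∀ x, Twin F a x → x = a
    · -- `a` is twin-free: Lemmas A and B on the projection and the partner family
      have hPu : ∀ A ∈ proj a F, A ⊆ u.erase a := proj_subset_erase hFu a
      have hlt : u.erase a ⊂ u := Finset.erase_ssubset hau
      have hP : Dichotomy (proj a F) :=
        ih _ hlt _ hPu (tight_proj_and_partner (r := a) hF).1
      have hK : (partner a F).Nonempty :=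
        partner_nonempty_of_twinFree hF ht₁ hat₁ ht₀ hat₀ htf hP
      have hKu : ∀ A ∈ partner a F, A ⊆ u.erase a :=
        fun A hA => hPu A (mem_proj_of_mem_part0 (mem_inter.1 hA).1)
      have hKd : Dichotomy (partner a F) :=
        ih _ hlt _ hKu (tight_proj_and_partner (r := a) hF).2.1
      exact closedAdd_or_closedRem_of_twinFree hF hK hKd htf
    · -- `a` has a twin `b ≠ a`: project along `b` and lift
      push Not at htf
      obtain ⟨b, hab, hba⟩ := htf
      have hbu : b ∈ u := hFu t₁ ht₁ ((hab t₁ ht₁).1 hat₁)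
      have hlt : u.erase b ⊂ u := Finset.erase_ssubset hbu
      have hPu : ∀ A ∈ proj b F, A ⊆ u.erase b := proj_subset_erase hFu b
      have hP : Dichotomy (proj b F) :=
        ih _ hlt _ hPu (tight_proj_and_partner (r := b) hF).1
      exact closedAdd_or_closedRem_of_proj (fun h => hba h.symm) hab ht₁ hat₁ (hP a)

/-- **Theorem S (the class dichotomy).** Every twin class of a tight family is addable or
removable. -/
theorem dichotomy_of_tight {F : Finset (Finset α)} (hF : Tight F) : Dichotomy F :=
  dichotomy_of_tight_aux Finset.univ F (fun _ _ => subset_univ _) hF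

/-- **Theorem S (the differences).** The differences of a tight family are its members flipped
along the addable part: `F \\ F = {A ∆ Rstar F : A ∈ F}`. -/
theorem diffs_eq_flip_of_tight {F : Finset (Finset α)} (hF : Tight F) :
    F \\ F = flip (Rstar F) F :=
  diffs_eq_flip_of_dichotomy (dichotomy_of_tight hF) hF

/-- **Theorem S (the product).** The flip of a tight family along its addable part is the product
of its members outside `Rstar F` and its members inside `Rstar F`. -/
theorem flip_eq_sups_within_of_tight {F : Finset (Finset α)} (hF : Tight F) :
    flip (Rstar F) F = within (flip (Rstar F) F) (Finset.univ \ Rstar F) ⊻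
      within (flip (Rstar F) F) (Rstar F) :=
  flip_eq_sups_within_of_dichotomy (dichotomy_of_tight hF) hF

/-- **Theorem S (product form).** A tight family is the product `L ⊻ U` of the family `L` of its
flipped members outside `Rstar F` (a class-down-set) and the family `U` of the complements within
`Rstar F` of its flipped members inside `Rstar F` (a class-up-set) — the paper's
«down-set ⊕ up-set» without contracting the twin classes. -/
theorem tight_eq_sups_of_tight {F : Finset (Finset α)} (hF : Tight F) :
    F = within (flip (Rstar F) F) (Finset.univ \ Rstar F) ⊻
      complWithin (Rstar F) (within (flip (Rstar F) F) (Rstar F)) := by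
  have hprod := flip_eq_sups_within_of_tight hF
  set M := Rstar F with hM
  ext A
  constructor
  · intro hA
    have hW : A ∆ M ∈ flip M F := symmDiff_mem_flip hA
    rw [hprod] at hW
    obtain ⟨X, hX, Y, hY, hXY⟩ := mem_sups.1 hW
    obtain ⟨_, hXN⟩ := mem_within.1 hX
    obtain ⟨_, hYM⟩ := mem_within.1 hY
    refine mem_sups.2 ⟨X, hX, M \ Y, mem_complWithin.2 ⟨Y, hY, rfl⟩, ?_⟩
    rw [sup_eq_union] at hXY ⊢
    have hAeq : A = (X ∪ Y) ∆ M := by rw [hXY, symmDiff_symmDiff_cancel_right]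
    rw [hAeq]
    ext s
    simp only [mem_symmDiff, mem_union, mem_sdiff]
    constructor
    · rintro (hs | ⟨hsM, hsY⟩)
      · exact Or.inl ⟨Or.inl hs, (mem_sdiff.1 (hXN hs)).2⟩
      · exact Or.inr ⟨hsM, fun h => h.elim (fun h' => (mem_sdiff.1 (hXN h')).2 hsM) hsY⟩
    · rintro (⟨hs | hs, hsM⟩ | ⟨hsM, hs⟩)
      · exact Or.inl hs
      · exact absurd (hYM hs) hsM
      · exact Or.inr ⟨hsM, fun h => hs (Or.inr h)⟩
  · intro hA
    obtain ⟨X, hX, Y', hY', hXY⟩ := mem_sups.1 hA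
    obtain ⟨Y, hY, rfl⟩ := mem_complWithin.1 hY'
    obtain ⟨_, hXN⟩ := mem_within.1 hX
    obtain ⟨_, hYM⟩ := mem_within.1 hY
    have hmem : X ∪ Y ∈ flip M F := by
      rw [hprod]
      exact mem_sups.2 ⟨X, hX, Y, hY, sup_eq_union⟩
    have hA' : (X ∪ Y) ∆ M ∈ F := symmDiff_mem_of_mem_flip hmem
    rw [sup_eq_union] at hXY
    rw [← hXY]
    convert hA' using 1
    ext s
    simp only [mem_symmDiff, mem_union, mem_sdiff]
    constructor
    · rintro (hs | ⟨hsM, hsY⟩)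
      · exact Or.inl ⟨Or.inl hs, (mem_sdiff.1 (hXN hs)).2⟩
      · exact Or.inr ⟨hsM, fun h => h.elim (fun h' => (mem_sdiff.1 (hXN h')).2 hsM) hsY⟩
    · rintro (⟨hs | hs, hsM⟩ | ⟨hsM, hs⟩)
      · exact Or.inl hs
      · exact absurd (hYM hs) hsM
      · exact Or.inr ⟨hsM, fun h => hs (Or.inr h)⟩

/-- **Theorem S as a characterisation.** A family is tight iff every twin class is addable or
removable and its flip along the addable part is the product of its two sides. -/
theorem tight_iff_dichotomy_and_flip_eq_sups {F : Finset (Finset α)} :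
    Tight F ↔ Dichotomy F ∧ flip (Rstar F) F = within (flip (Rstar F) F) (Finset.univ \ Rstar F) ⊻
      within (flip (Rstar F) F) (Rstar F) := by
  constructor
  · intro hF
    exact ⟨dichotomy_of_tight hF, flip_eq_sups_within_of_tight hF⟩
  · rintro ⟨hD, hprod⟩
    show (F \\ F).card = F.card
    rw [diffs_eq_sups_within_of_dichotomy hD, ← hprod, card_flip]

/-- **Corollary (difference-closure).** The difference family of a tight family is itself
difference-closed: `(F \\ F) \\ (F \\ F) = F \\ F`. -/
theorem diffs_diffs_eq_of_tight {F : Finset (Finset α)} (hF : Tight F) :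
    (F \\ F) \\ (F \\ F) = F \\ F := by
  have hD := dichotomy_of_tight hF
  apply Finset.Subset.antisymm
  · intro E hE
    obtain ⟨X, hX, Y, hY, rfl⟩ := mem_diffs.1 hE
    rw [diffs_eq_flip_of_tight hF] at hX hY ⊢
    exact mem_flip_of_subset_of_twinClosed hD hX sdiff_subset
      ((twinClosed_of_mem_flip hX).sdiff (twinClosed_of_mem_flip hY))
  · intro E hE
    obtain ⟨A, hA, _, _, rfl⟩ := mem_diffs.1 hE
    have h0 : (∅ : Finset α) ∈ F \\ F := mem_diffs.2 ⟨A, hA, A, hA, Finset.sdiff_self A⟩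
    exact mem_diffs.2 ⟨_, hE, ∅, h0, Finset.sdiff_empty⟩

/-- **Corollary (atoms).** Every twin class of a tight family that lies in some member and
misses another is a difference. -/
theorem cls_mem_diffs_of_tight {F : Finset (Finset α)} (hF : Tight F) {a : α} {t₁ : Finset α}
    (ht₁ : t₁ ∈ F) (ha₁ : a ∈ t₁) {t₀ : Finset α} (ht₀ : t₀ ∈ F) (ha₀ : a ∉ t₀) :
    cls F a ∈ F \\ F := by
  have hD := dichotomy_of_tight hF
  rw [diffs_eq_flip_of_tight hF]
  by_cases hR : a ∈ Rstar F
  · refine mem_flip_of_subset_of_twinClosed hD (symmDiff_mem_flip (M := Rstar F) ht₀) ?_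
      (twinClosed_cls F a)
    intro x hx
    rw [mem_symmDiff]
    exact Or.inr ⟨cls_subset_of_twinClosed (twinClosed_Rstar F) hR hx,
      disjoint_left.1 (disjoint_cls_of_notMem ht₀ ha₀) hx⟩
  · refine mem_flip_of_subset_of_twinClosed hD (symmDiff_mem_flip (M := Rstar F) ht₁) ?_
      (twinClosed_cls F a)
    intro x hx
    rw [mem_symmDiff]
    exact Or.inl ⟨cls_subset_of_mem ht₁ ha₁ hx,
      disjoint_left.1 (disjoint_cls_of_twinClosed_of_notMem (twinClosed_Rstar F) hR) hx⟩

/-- Every nonempty difference contains a twin class (differences are twin-closed): with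
`cls_mem_diffs_of_tight`, the minimal nonempty differences of a tight family are exactly its
twin classes inside the support. -/
theorem exists_cls_subset_of_mem_diffs {F : Finset (Finset α)} {E : Finset α} (hE : E ∈ F \\ F)
    (hne : E.Nonempty) : ∃ a ∈ E, cls F a ⊆ E := by
  obtain ⟨a, ha⟩ := hne
  exact ⟨a, ha, cls_subset_of_twinClosed (twinClosed_of_mem_diffs hE) ha⟩

/-- A tight family is convex on twin-closed sets. -/
theorem mem_of_subset_of_subset_of_twinClosed_of_tight {F : Finset (Finset α)} (hF : Tight F)
    {x y z : Finset α} (hx : x ∈ F) (hy : y ∈ F) (hxz : x ⊆ z) (hzy : z ⊆ y)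
    (hz : TwinClosed F z) : z ∈ F :=
  mem_of_subset_of_subset_of_twinClosed (dichotomy_of_tight hF) hF hx hy hxz hzy hz

/-- **The general mixed-cell lemma (TL).** For every tight nonempty family `F` and every `w`: if
each member `t` has both agreement cells `t ∩ w`, `tᶜ ∩ wᶜ` or both disagreement cells `t ∩ wᶜ`,
`tᶜ ∩ w` among the differences of `F`, then `w` or `wᶜ` is a member. -/
theorem mem_or_compl_mem_of_tight {F : Finset (Finset α)} (hF : Tight F) (hne : F.Nonempty)
    (w : Finset α)
    (hcond : ∀ t ∈ F, (t ∩ w ∈ F \\ F ∧ (Finset.univ \ t) ∩ (Finset.univ \ w) ∈ F \\ F) ∨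
      (t ∩ (Finset.univ \ w) ∈ F \\ F ∧ (Finset.univ \ t) ∩ w ∈ F \\ F)) :
    w ∈ F ∨ Finset.univ \ w ∈ F :=
  mem_or_compl_mem_of_dichotomy (dichotomy_of_tight hF) hF hne w hcond

end PercRepro.MSTight

namespace PercRepro

/-- **`TLGeneral` holds for every finite type**: the candidate proposition of `MS3RegimeTL.lean`
is a theorem. -/
theorem tlGeneral (S : Type) [Fintype S] [DecidableEq S] : TLGeneral S :=
  fun _ w hF hne hcond => MSTight.mem_or_compl_mem_of_tight hF hne w hcond

/-- **`MSr 3` whenever some type has at most one pair**, unconditionally: the regime theorem of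
`MS3RegimeTL.lean` with its hypothesis `TLGeneral S` discharged. -/
theorem msr3_card_le_of_small_type' {S : Type} [Fintype S] [DecidableEq S]
    (T : Finset (Config S)) (κ : Config S → Fin 3) (hT : ∀ A ∈ T, Aᶜ ∈ T)
    (hκ : ∀ A ∈ T, κ Aᶜ ≠ κ A) (i : Fin 3) (hsmall : (avoidMembers T κ i).card ≤ 2) :
    T.card ≤ 2 * (classDiffs T κ).card :=
  msr3_card_le_of_small_type_of_TL (tlGeneral S) T κ hT hκ i hsmall

end PercRepro
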